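import Literature.Geometry.Manifold.VectorSpaceGlobalFlow
import Summits.SmoothPoincare4.SmoothPoincare4.Theorems.DottedCircleRasmussenDcrGapStubFriendsH2HF3
import Summits.SmoothPoincare4.SmoothPoincare4.Theses.DottedCircleRasmussen

/-!
# Helper `helper_friendsCarrier_Vk_clockFlow` (piece 1 of the registered helper `helper_friendsCarrier_Vk`,
stub `stub_friendsCarrier`, line `mk_friends`, skeleton v5) for crux `DcrGap`
(item stmt-SmoothPoincare4-16128, route route-SmoothPoincare4-DottedCircleRasmussen)

**The exterior collar of the model boundary `M_k = ∂D_k` as a clocked flow.**  The `Y`-collared end of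
the model disc exterior (debt V_k of the carrier stub) is built, as in the tree's `k = 0` template
(`SliceDiscEndCollar.lean`, where the collar coordinate of `S³ ⊂ ℝ⁴` is the radius), from a collar of
`M_k = {G_k = 1}` in `ℝ⁴` whose slices are the level sets of the model level function
`G_k = MMSW.levelFun k`.  There is no radial structure for `k ≥ 1`; the collar is the flow of a vector
field `V` with `dG_k(V) = 1` near `M_k` (Milnor, *Morse theory*, Thm. 3.1; the normalised gradient
`∇G_k/|∇G_k|²`, or — for the straightening of the slice disc — any field tangent to the disc with the
same clock).  This file proves the flow half once and for all, for an ARBITRARY compactly supported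
smooth field `V` on `ℝ⁴` with `dG_k(V) = 1` on the open clock zone
`O = {∀ j, |z - c_j|² > 1/2} ∩ {|G_k - 1| < 3ε}` (`0 < ε ≤ 1/4`):

* the global flow `Φ : ℝ × ℝ⁴ → ℝ⁴` of `V` exists and is `C^∞` (tree:
  `Literature.Geometry.Manifold.exists_contDiff_globalFlow`), with the group law, the flow equation
  and stationarity at the zeros of `V`;
* **clock**: for `x ∈ M_k` and `|s| ≤ 2ε` the point `Φ(s, x)` lies in the clock zone and
  `G_k(Φ(s, x)) = 1 + s` (continuous induction on the time interval: the set of good times is closed,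
  and open because the clock zone is open and `d/dt G_k(Φ(t, x)) = dG_k(V) = 1` there);
* **band**: every point `y` off the poles with `|G_k(y) - 1| < 2ε` is reached: `Φ(1 - G_k(y), y) ∈ M_k`,
  i.e. `y = Φ(G_k(y) - 1, x)` with `x ∈ M_k` — the flow restricted to `M_k × (-2ε, 2ε)` is a bijection
  onto the open band `{|G_k - 1| < 2ε}` (off the poles), inverted by `y ↦ (Φ(1 - G_k y, y), G_k y - 1)`.

`FriendsCarrierVk.clock_along` is the continuous-induction lemma along one curve;
`helper_friendsCarrier_Vk_clockFlow` the registered statement.  No definitions, no named facts, no `sorry`.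

## References

* J. Milnor, *Morse theory*, Ann. of Math. Studies 51 (1963), Thm. 3.1 (the diffeomorphism
  `M^a ≅ M^b` across a band without critical points, by the flow of `∇f/|∇f|²`). [Milnor1963]
* J. M. Lee, *Introduction to Smooth Manifolds*, 2nd ed. (2013), Thm. 9.16 (compactly supported fields
  are complete). [LeeSmoothManifolds2013]
-/

-- the prescribed namespace `Summit.<P>.<Sub>.…` duplicates `SmoothPoincare4` (P = Sub)
set_option linter.dupNamespace false
set_option linter.style.longLine false

noncomputable section

open scoped ContDiff Topology
open Set Function Metric Filter
open Literature.Topology.FourManifolds Literature.Topology.FourManifolds.MMSW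

namespace Summit.SmoothPoincare4.SmoothPoincare4.Theorems.DcrGap.MkFriends

namespace FriendsCarrierVk

/-! ## The clock zone -/

/-- The clock zone `{∀ j, 1/2 < |z - c_j|²} ∩ {G_k ∈ (1 - 3ε, 1 + 3ε)}` is open. [folklore] -/
theorem isOpen_clockZone (k : ℕ) (ε : ℝ) :
    IsOpen ({y : EuclideanSpace ℝ (Fin 4) | ∀ j : Fin k, (1 : ℝ) / 2 < holeTerm k j y} ∩
      levelFun k ⁻¹' Ioo (1 - 3 * ε) (1 + 3 * ε)) := by
  have hc : ContinuousOn (levelFun k) {y : EuclideanSpace ℝ (Fin 4) | ∀ j : Fin k, (1 : ℝ) / 2 < holeTerm k j y} :=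
    (continuousOn_levelFun (by norm_num : (0 : ℝ) < 1 / 2)).mono fun y hy j => (hy j).le
  exact hc.isOpen_inter_preimage (isOpen_guard (1 / 2)) isOpen_Ioo

/-- Off the poles, a point with `G_k < 2` has all hole terms `> 1/2`, and a point with `G_k = 1` lies on
`M_k` (the guard `1 ≤ |z - c_j|²` follows from `1/|z - c_j|² ≤ G_k = 1`). [folklore] -/
theorem mem_modelBoundary_of_levelFun_eq_one {k : ℕ} {y : EuclideanSpace ℝ (Fin 4)}
    (hy : ∀ j, 0 < holeTerm k j y) (h1 : levelFun k y = 1) : y ∈ modelBoundary k := by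
  refine ⟨fun j => ?_, h1⟩
  have h := (FriendsH2.levelFun_bounds hy).2.2 j
  rw [h1, div_le_one (hy j)] at h
  exact h

/-- An affine function of `t` bounded by `2ε` in absolute value at `t = 0` and `t = b` is bounded by
`2ε` on `[0, b]`. [folklore] -/
theorem abs_affine_le {c σ b t e : ℝ} (h0 : |c| ≤ e) (hb : |c + σ * b| ≤ e) (ht0 : 0 ≤ t) (htb : t ≤ b) :
    |c + σ * t| ≤ e := by
  rw [abs_le] at h0 hb ⊢
  rcases le_or_gt 0 σ with hσ | hσ
  · have h1 : 0 ≤ σ * t := mul_nonneg hσ ht0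
    have h2 : σ * t ≤ σ * b := mul_le_mul_of_nonneg_left htb hσ
    constructor <;> linarith
  · have h1 : σ * t ≤ 0 := mul_nonpos_of_nonpos_of_nonneg hσ.le ht0
    have h2 : σ * b ≤ σ * t := mul_le_mul_of_nonpos_left htb hσ.le
    constructor <;> linarith

/-! ## Continuous induction along one curve -/

/-- **The clock along a curve.**  Let `γ` be a continuous curve in `ℝ⁴` such that
`t ↦ G_k(γ t)` has derivative `σ` whenever `γ t` lies in the clock zone
`{∀ j, |z - c_j|² > 1/2} ∩ {|G_k - 1| < 3ε}`, `0 < ε ≤ 1/4`.  If `γ 0` is off the poles with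
`|G_k(γ 0) - 1| ≤ 2ε` and the affine clock value at time `b` still satisfies
`|G_k(γ 0) - 1 + σ b| ≤ 2ε`, then for all `t ∈ [0, b]` the point `γ t` is in the clock zone and
`G_k(γ t) = G_k(γ 0) + σ t` (the set of such times is closed, contains `0`, and is a neighbourhood of
each of its points before `b`: continuous induction, `IsClosed.Icc_subset_of_forall_mem_nhdsWithin`).
[cite: Milnor1963, Thm. 3.1] -/
theorem clock_along {k : ℕ} {ε σ b : ℝ} {γ : ℝ → EuclideanSpace ℝ (Fin 4)} (hγ : Continuous γ)
    (hε0 : 0 < ε) (hε : ε ≤ 1 / 4)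
    (hO : ∀ t, (∀ j, (1 : ℝ) / 2 < holeTerm k j (γ t)) → |levelFun k (γ t) - 1| < 3 * ε →
      HasDerivAt (fun τ => levelFun k (γ τ)) σ t)
    (h0 : ∀ j, 0 < holeTerm k j (γ 0)) (hG0 : |levelFun k (γ 0) - 1| ≤ 2 * ε)
    (hGb : |levelFun k (γ 0) - 1 + σ * b| ≤ 2 * ε) :
    ∀ t ∈ Icc 0 b, (∀ j, (1 : ℝ) / 2 < holeTerm k j (γ t)) ∧ levelFun k (γ t) = levelFun k (γ 0) + σ * t := by
  set G₀ : ℝ := levelFun k (γ 0) with hG₀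
  -- the closed guard set along the curve and the set of good times
  set A : Set ℝ := {t | ∀ j : Fin k, (1 : ℝ) / 2 ≤ holeTerm k j (γ t)} with hA
  have hAc : IsClosed A := (isClosed_guard (r := k) (1 / 2)).preimage hγ
  have hcont : ContinuousOn (fun t => levelFun k (γ t) - σ * t) A := by
    refine ContinuousOn.sub ?_ (by fun_prop)
    exact (continuousOn_levelFun (by norm_num : (0 : ℝ) < 1 / 2)).comp hγ.continuousOn fun t ht => ht
  set s : Set ℝ := A ∩ (fun t => levelFun k (γ t) - σ * t) ⁻¹' {G₀} with hs
  have hsc : IsClosed s := hcont.preimage_isClosed_of_isClosed hAc isClosed_singleton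
  -- from membership in `s` at a time in `[0, b]` to the clock zone
  have hzone : ∀ t, t ∈ s → 0 ≤ t → t ≤ b →
      (∀ j, (1 : ℝ) / 2 < holeTerm k j (γ t)) ∧ levelFun k (γ t) = G₀ + σ * t ∧
        |levelFun k (γ t) - 1| < 3 * ε := by
    intro t ht ht0 htb
    have hAt : t ∈ A := ht.1
    have hEq : levelFun k (γ t) - σ * t = G₀ := ht.2
    have hG : levelFun k (γ t) = G₀ + σ * t := by linarith
    have habs : |levelFun k (γ t) - 1| ≤ 2 * ε := by
      rw [hG, show G₀ + σ * t - 1 = (G₀ - 1) + σ * t by ring]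
      exact abs_affine_le hG0 hGb ht0 htb
    have hpos : ∀ j, 0 < holeTerm k j (γ t) := fun j => lt_of_lt_of_le (by norm_num) (hAt j)
    have hlt2 : levelFun k (γ t) < 2 := by
      have := (abs_le.1 habs).2
      linarith
    refine ⟨fun j => FriendsH2.half_lt_holeTerm_of_levelFun_lt_two hpos hlt2 j, hG, ?_⟩
    exact lt_of_le_of_lt habs (by linarith)
  -- continuous induction
  have hsub : Icc 0 b ⊆ s := by
    refine (hsc.inter isClosed_Icc).Icc_subset_of_forall_mem_nhdsWithin ?_ ?_
    · -- `0 ∈ s`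
      have hlt2 : levelFun k (γ 0) < 2 := by
        have := (abs_le.1 hG0).2
        linarith
      refine ⟨fun j => (FriendsH2.half_lt_holeTerm_of_levelFun_lt_two h0 hlt2 j).le, ?_⟩
      show levelFun k (γ 0) - σ * 0 ∈ ({G₀} : Set ℝ)
      simp [hG₀]
    · rintro t ⟨hts, ht0, htb⟩
      obtain ⟨hhalf, hG, habs⟩ := hzone t hts ht0 htb.le
      -- the curve stays in the open clock zone near `t`
      have hmem : γ t ∈ ({y : EuclideanSpace ℝ (Fin 4) | ∀ j : Fin k, (1 : ℝ) / 2 < holeTerm k j y} ∩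
          levelFun k ⁻¹' Ioo (1 - 3 * ε) (1 + 3 * ε)) := by
        refine ⟨hhalf, ?_⟩
        have := abs_lt.1 habs
        exact ⟨by linarith [this.1], by linarith [this.2]⟩
      have hnhds : γ ⁻¹' ({y : EuclideanSpace ℝ (Fin 4) | ∀ j : Fin k, (1 : ℝ) / 2 < holeTerm k j y} ∩
          levelFun k ⁻¹' Ioo (1 - 3 * ε) (1 + 3 * ε)) ∈ 𝓝 t :=
        hγ.continuousAt.preimage_mem_nhds ((isOpen_clockZone k ε).mem_nhds hmem)
      obtain ⟨δ, hδ, hball⟩ := Metric.mem_nhds_iff.1 hnhds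
      -- on the interval `(t - δ, t + δ)` the clock has derivative `σ`, hence is affine
      have hder : ∀ τ ∈ Ioo (t - δ) (t + δ), HasDerivAt (fun τ => levelFun k (γ τ) - σ * τ) 0 τ := by
        intro τ hτ
        have hτb : τ ∈ ball t δ := by rw [Real.ball_eq_Ioo]; exact hτ
        have hz := hball hτb
        have h1 : HasDerivAt (fun τ => levelFun k (γ τ)) σ τ := by
          refine hO τ hz.1 ?_
          have := hz.2
          rw [abs_lt]
          exact ⟨by linarith [this.1], by linarith [this.2]⟩
        have h2 : HasDerivAt (fun τ : ℝ => σ * τ) σ τ := by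
          simpa using (hasDerivAt_id τ).const_mul σ
        have h3 := h1.fun_sub h2
        rwa [sub_self] at h3
      have hconst : ∀ τ ∈ Ioo (t - δ) (t + δ), levelFun k (γ τ) - σ * τ = levelFun k (γ t) - σ * t := by
        intro τ hτ
        have ht' : t ∈ Ioo (t - δ) (t + δ) := ⟨by linarith, by linarith⟩
        exact isOpen_Ioo.is_const_of_deriv_eq_zero isPreconnected_Ioo
          (fun x hx => (hder x hx).differentiableAt.differentiableWithinAt)
          (fun x hx => (hder x hx).deriv) hτ ht'
      -- hence the whole interval consists of good times
      have hI : Ioo (t - δ) (t + δ) ⊆ s := by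
        intro τ hτ
        have hτb : τ ∈ ball t δ := by rw [Real.ball_eq_Ioo]; exact hτ
        have hz := hball hτb
        refine ⟨fun j => (hz.1 j).le, ?_⟩
        show levelFun k (γ τ) - σ * τ ∈ ({G₀} : Set ℝ)
        rw [mem_singleton_iff, hconst τ hτ]
        exact hts.2
      exact mem_nhdsWithin_of_mem_nhds (Filter.mem_of_superset (Ioo_mem_nhds (by linarith) (by linarith)) hI)
  intro t ht
  obtain ⟨hhalf, hG, -⟩ := hzone t (hsub ht) ht.1 ht.2
  exact ⟨hhalf, hG⟩

end FriendsCarrierVk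

open FriendsCarrierVk in
/-- **Helper `helper_friendsCarrier_Vk_clockFlow`** (registered piece of `helper_friendsCarrier_Vk`: the
exterior collar of `M_k` as a clocked flow).  For every `k`, every `0 < ε ≤ 1/4` and every `C^∞` vector
field `V` on `ℝ⁴` vanishing outside a ball and satisfying `dG_k(V) = 1` on the clock zone
`{∀ j, |z - c_j|² > 1/2} ∩ {|G_k - 1| < 3ε}`, the global flow `Φ` of `V` is `C^∞`, satisfies
`Φ(0, x) = x`, the group law, the flow equation and stationarity at the zeros of `V`, and:
for `x ∈ M_k` and `|s| ≤ 2ε` the point `Φ(s, x)` is in the clock zone with `G_k(Φ(s, x)) = 1 + s`;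
every `y` off the poles with `|G_k(y) - 1| < 2ε` has `Φ(1 - G_k(y), y) ∈ M_k`.
[cite: Milnor1963, Thm. 3.1] -/
theorem helper_friendsCarrier_Vk_clockFlow : ∀ (k : ℕ) (V : EuclideanSpace ℝ (Fin 4) → EuclideanSpace ℝ (Fin 4)) (ε R : ℝ), 0 < ε → ε ≤ 1 / 4 → ContDiff ℝ ((⊤ : ℕ∞) : WithTop ℕ∞) V → (∀ y, R ≤ ‖y‖ → V y = 0) → (∀ y, (∀ j, (1 : ℝ) / 2 < Literature.Topology.FourManifolds.MMSW.holeTerm k j y) → |Literature.Topology.FourManifolds.MMSW.levelFun k y - 1| < 3 * ε → fderiv ℝ (Literature.Topology.FourManifolds.MMSW.levelFun k) y (V y) = 1) → ∃ Φ : ℝ × EuclideanSpace ℝ (Fin 4) → EuclideanSpace ℝ (Fin 4), ContDiff ℝ ((⊤ : ℕ∞) : WithTop ℕ∞) Φ ∧ (∀ x, Φ (0, x) = x) ∧ (∀ s t x, Φ (s, Φ (t, x)) = Φ (s + t, x)) ∧ (∀ x s, HasDerivAt (fun s : ℝ => Φ (s, x)) (V (Φ (s, x))) s) ∧ (∀ x,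 V x = 0 → ∀ s, Φ (s, x) = x) ∧ (∀ x ∈ Literature.Topology.FourManifolds.MMSW.modelBoundary k, ∀ s : ℝ, |s| ≤ 2 * ε → (∀ j, (1 : ℝ) / 2 < Literature.Topology.FourManifolds.MMSW.holeTerm k j (Φ (s, x))) ∧ Literature.Topology.FourManifolds.MMSW.levelFun k (Φ (s, x)) = 1 + s) ∧ (∀ y, (∀ j, 0 < Literature.Topology.FourManifolds.MMSW.holeTerm k j y) → |Literature.Topology.FourManifolds.MMSW.levelFun k y - 1| < 2 * ε → Φ (1 - Literature.Topology.FourManifolds.MMSW.levelFun k y, y) ∈ Literature.Topology.FourManifolds.MMSW.modelBoundary k) := by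
  intro k V ε R hε0 hε hV hVR hclock
  -- the global flow of the compactly supported field
  have hVK : ∀ x, x ∉ closedBall (0 : EuclideanSpace ℝ (Fin 4)) R → V x = 0 := fun x hx =>
    hVR x (le_of_lt (by simpa [mem_closedBall, dist_zero_right] using hx))
  obtain ⟨Φ, hΦs, h0, hadd, hder, hfix⟩ :=
    Literature.Geometry.Manifold.exists_contDiff_globalFlow hV (isCompact_closedBall (0 : EuclideanSpace ℝ (Fin 4)) R) hVK
  -- the clock derivative along forward and backward orbits inside the clock zone
  have hfwd : ∀ (x : EuclideanSpace ℝ (Fin 4)) (t : ℝ), (∀ j, (1 : ℝ) / 2 < holeTerm k j (Φ (t, x))) →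
      |levelFun k (Φ (t, x)) - 1| < 3 * ε → HasDerivAt (fun τ => levelFun k (Φ (τ, x))) 1 t := by
    intro x t hh hG
    have hne : ∀ j, holeTerm k j (Φ (t, x)) ≠ 0 := fun j => (lt_trans (by norm_num) (hh j)).ne'
    have hGd : HasFDerivAt (levelFun k) (fderiv ℝ (levelFun k) (Φ (t, x))) (Φ (t, x)) :=
      ((contDiffAt_levelFun hne).differentiableAt (by simp)).hasFDerivAt
    have h := hGd.comp_hasDerivAt t (hder x t)
    rwa [hclock _ hh hG] at h
  have hbwd : ∀ (x : EuclideanSpace ℝ (Fin 4)) (t : ℝ), (∀ j, (1 : ℝ) / 2 < holeTerm k j (Φ (-t, x))) →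
      |levelFun k (Φ (-t, x)) - 1| < 3 * ε → HasDerivAt (fun τ => levelFun k (Φ (-τ, x))) (-1) t := by
    intro x t hh hG
    have hne : ∀ j, holeTerm k j (Φ (-t, x)) ≠ 0 := fun j => (lt_trans (by norm_num) (hh j)).ne'
    have hGd : HasFDerivAt (levelFun k) (fderiv ℝ (levelFun k) (Φ (-t, x))) (Φ (-t, x)) :=
      ((contDiffAt_levelFun hne).differentiableAt (by simp)).hasFDerivAt
    have hγ : HasDerivAt (fun τ : ℝ => Φ (-τ, x)) ((-1 : ℝ) • V (Φ (-t, x))) t :=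
      (hder x (-t)).scomp t (hasDerivAt_neg (x := t))
    have h := hGd.comp_hasDerivAt t hγ
    rw [map_smul, hclock _ hh hG, smul_eq_mul, mul_one] at h
    exact h
  have hcf : ∀ x : EuclideanSpace ℝ (Fin 4), Continuous fun τ : ℝ => Φ (τ, x) := fun x =>
    hΦs.continuous.comp (by fun_prop)
  have hcb : ∀ x : EuclideanSpace ℝ (Fin 4), Continuous fun τ : ℝ => Φ (-τ, x) := fun x =>
    hΦs.continuous.comp (by fun_prop)
  refine ⟨Φ, hΦs, h0, hadd, hder, hfix, fun x hx s hs => ?_, fun y hy hGy => ?_⟩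
  · -- the clock on `M_k`
    have hx0 : ∀ j, 0 < holeTerm k j x := fun j => lt_of_lt_of_le one_pos (hx.1 j)
    have hG1 : levelFun k x = 1 := hx.2
    rcases le_or_gt 0 s with hs0 | hs0
    · have h := clock_along (σ := 1) (b := s) (hcf x) hε0 hε (fun t hh hG => hfwd x t hh hG)
        (by simpa only [h0] using hx0) (by simp [h0, hG1]; positivity)
        (by rw [h0, hG1]; simpa [abs_of_nonneg hs0] using (abs_le.1 hs).2)
      obtain ⟨hh, hG⟩ := h s ⟨hs0, le_rfl⟩
      exact ⟨hh, by rw [hG, h0, hG1, one_mul]⟩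
    · have hs' : 0 ≤ -s := by linarith
      have h := clock_along (σ := -1) (b := -s) (hcb x) hε0 hε (fun t hh hG => hbwd x t hh hG)
        (by simpa only [neg_zero, h0] using hx0) (by simp [h0, hG1]; positivity)
        (by rw [neg_zero, h0, hG1]; have := (abs_le.1 hs).1; rw [abs_le]; constructor <;> linarith)
      obtain ⟨hh, hG⟩ := h (-s) ⟨hs', le_rfl⟩
      simp only [neg_neg, neg_zero, h0, hG1] at hh hG
      exact ⟨hh, by rw [hG]; ring⟩
  · -- the band: flowing back to `M_k`
    set s₀ : ℝ := levelFun k y - 1 with hs₀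
    have h1s : 1 - levelFun k y = -s₀ := by rw [hs₀]; ring
    rw [h1s]
    rcases le_or_gt 0 s₀ with hs0 | hs0
    · have h := clock_along (σ := -1) (b := s₀) (hcb y) hε0 hε (fun t hh hG => hbwd y t hh hG)
        (by simpa only [neg_zero, h0] using hy) (by rw [neg_zero, h0]; exact hGy.le)
        (by rw [neg_zero, h0, ← hs₀]; simp; positivity)
      obtain ⟨hh, hG⟩ := h s₀ ⟨hs0, le_rfl⟩
      rw [neg_zero, h0] at hG
      refine mem_modelBoundary_of_levelFun_eq_one (fun j => lt_trans (by norm_num) (hh j)) ?_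
      rw [hG, hs₀]; ring
    · have hs' : 0 ≤ -s₀ := by linarith
      have h := clock_along (σ := 1) (b := -s₀) (hcf y) hε0 hε (fun t hh hG => hfwd y t hh hG)
        (by simpa only [h0] using hy) (by rw [h0]; exact hGy.le)
        (by rw [h0, ← hs₀]; simp; positivity)
      obtain ⟨hh, hG⟩ := h (-s₀) ⟨hs', le_rfl⟩
      rw [h0] at hG
      refine mem_modelBoundary_of_levelFun_eq_one (fun j => lt_trans (by norm_num) (hh j)) ?_
      rw [hG, hs₀]; ring

end Summit.SmoothPoincare4.SmoothPoincare4.Theorems.DcrGap.MkFriends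

end
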